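import Summits.ValiantsHypothesis.ValiantsHypothesis.Theorems.KPlusLogSqLawTropicalBSplitDefs
import Summits.ValiantsHypothesis.ValiantsHypothesis.Theorems.KPlusLogSqLawTropicalBSplitGlue

/-!
# Route `KPlusLogSqLaw`, crux `TropicalB` (stmt-ValiantsHypothesis-19771) — STRIP SLOPE COUNTING: only the width of the slope-carrying
# strip enters the counting bound, `DesignRowD ≤ multichoose K w − 1`

HONEST FRAMING.  Helper file (seat val-sym-trop-p1 g16, cell `pub-symmetroid`, 2026-08-28) toward the registered stubs `stub_tropThin` /
`stub_tropFat` of `Cruxes/TropicalB/Lines/birth.lean` (crux `Summit.ValiantsHypothesis.ValiantsHypothesis.Theses.KPlusLogSqLaw.TropicalB`,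
item `stmt-ValiantsHypothesis-19771`, route `KPlusLogSqLaw`; `--supports … --as helper`).  A COUNTING law, companion of the menu normal form
`…TropicalBOneCut` (`OneCut.tropRowD_of_strip`: menu designs of width `m` and format `((m+1)·m, K+1)` are universal); it bounds nothing for
`TropicalB` in its window and bears on neither `WeakLifting`, the doors, `MatrixDescartes` (stmt-ValiantsHypothesis-18050) nor VP ≠ VNP.

THE LAW.  If in a design `(d, v, ε)` of format `(M, K)` every present entry in a column of index `≥ w` (`w ≤ M`) carries a class of exponent
`0` — condition (1) of the menu normal form, on its own a triviality-preserving padding condition — then every unsigned dominant chain has at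
most `multichoose K w` terms: the slope of a present term is the exponent sum over the STRIP columns `< w` only, slopes strictly increase
along the chain (`slope_strictMono_of_chainD`), so the strip class multisets (elements of `Sym (Fin K) w`) are pairwise distinct.

* `sum_strip_eq` — for a present term the exponent sum over all columns equals the sum over the strip, re-indexed by `Fin w`;
* `designRowD_strip_slopeCount` — **`DesignRowD d v ε (Nat.multichoose K w − 1)`** under condition (1) with `w ≤ M`.

So the size `M` of a menu design is invisible to counting; at the normal form's format (`w = m`, `K+1` classes, the last of exponent `0`)
the bound is `multichoose (K+1) m − 1`, the original format's count up to the idle class — the strip width `m` of `…TropicalBOneCut` cannot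
be lowered below the counting threshold of the format it simulates.  [folklore] (counting)
-/

set_option linter.dupNamespace false
set_option autoImplicit false

namespace Summit.ValiantsHypothesis.ValiantsHypothesis.Theorems.KPlusLogSqLaw

open Summit.ValiantsHypothesis.ValiantsHypothesis.Theorems.MatrixDescartes.Negative
open Summit.ValiantsHypothesis.ValiantsHypothesis.Theorems.LacunarySymmetroidMatrixDescartes
open scoped BigOperators
open Finset
namespace OneCut

variable {M K : ℕ}

/-- For a term whose columns of index `≥ w` carry exponent `0`, the total exponent is the exponent sum over the strip columns `< w`,
re-indexed by `Fin w` through `Fin.castLE`. [folklore] -/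
theorem sum_strip_eq (w : ℕ) (hw : w ≤ M) (d : Fin K → ℕ) (q : Equiv.Perm (Fin M) × (Fin M → Fin K))
    (hq : ∀ i : Fin M, w ≤ (i : ℕ) → d (q.2 i) = 0) :
    ∑ i : Fin M, (d (q.2 i) : ℤ) = ∑ j : Fin w, (d (q.2 (Fin.castLE hw j)) : ℤ) := by
  classical
  have himage : (Finset.univ : Finset (Fin w)).image (Fin.castLE hw) = Finset.univ.filter (fun i : Fin M => (i : ℕ) < w) := by
    ext i
    simp only [Finset.mem_image, Finset.mem_univ, true_and, Finset.mem_filter]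
    constructor
    · rintro ⟨j, rfl⟩; exact j.isLt
    · intro hi; exact ⟨⟨i, hi⟩, Fin.ext rfl⟩
  rw [← Finset.sum_filter_add_sum_filter_not Finset.univ (fun i : Fin M => (i : ℕ) < w)]
  have hzero : ∑ i ∈ Finset.univ.filter (fun i : Fin M => ¬ (i : ℕ) < w), (d (q.2 i) : ℤ) = 0 := by
    refine Finset.sum_eq_zero fun i hi => ?_
    rw [Finset.mem_filter] at hi
    rw [hq i (not_lt.mp hi.2)]; rfl
  rw [hzero, add_zero, ← himage, Finset.sum_image]
  intro j _ j' _ h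
  exact Fin.castLE_injective hw h

/-- **STRIP SLOPE COUNTING.**  If every present entry in a column of index `≥ w` (`w ≤ M`) carries a class of exponent `0`, then every
unsigned dominant chain of the design has at most `multichoose K w` terms: `DesignRowD d v ε (multichoose K w − 1)`. [folklore] -/
theorem designRowD_strip_slopeCount (w : ℕ) (hw : w ≤ M) (d : Fin K → ℕ) (v ε : Fin M → Fin M → Fin K → ℤ)
    (hstrip : ∀ (a b : Fin M) (l : Fin K), w ≤ (b : ℕ) → ε a b l ≠ 0 → d l = 0) :
    DesignRowD d v ε (Nat.multichoose K w - 1) := by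
  classical
  intro n θ p hθ hdom hne
  have hsm := slope_strictMono_of_chainD d v ε θ p hθ hdom hne
  -- the strip class multiset of a chain term
  let key : Fin (n + 1) → Sym (Fin K) w := fun k =>
    ⟨(Finset.univ : Finset (Fin w)).val.map (fun j => (p k).2 (Fin.castLE hw j)), by simp⟩
  have hslope : ∀ k, TropicalCensus.slope d (p k) = (((key k : Sym (Fin K) w) : Multiset (Fin K)).map fun l => (d l : ℤ)).sum := by
    intro k
    have hpres := (termSign_ne_zero_iff ε (p k)).1 (hdom k).1
    unfold TropicalCensus.slope
    rw [sum_strip_eq w hw d (p k) (fun i hi => hstrip _ i _ hi (hpres i))]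
    simp only [key, Sym.coe_mk, Multiset.map_map]
    rfl
  have hinj : Function.Injective key := by
    intro k k' h
    apply hsm.injective
    simp only
    rw [hslope, hslope, h]
  have hcard := Fintype.card_le_of_injective _ hinj
  rw [Fintype.card_fin, Sym.card_sym_eq_multichoose, Fintype.card_fin] at hcard
  omega

/-- At the format of the menu normal form (`…TropicalBOneCut`: width `m`, format `((m+1)·m, K+1)`), counting sees only the strip:
`DesignRowD ≤ multichoose (K+1) m − 1`. [folklore] -/
theorem designRowD_menu_slopeCount (m K : ℕ) (d' : Fin (K + 1) → ℕ)
    (v' ε' : Fin ((m + 1) * m) → Fin ((m + 1) * m) → Fin (K + 1) → ℤ)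
    (hstrip : ∀ (a b : Fin ((m + 1) * m)) (l : Fin (K + 1)), m ≤ (b : ℕ) → ε' a b l ≠ 0 → d' l = 0) :
    DesignRowD d' v' ε' (Nat.multichoose (K + 1) m - 1) :=
  designRowD_strip_slopeCount m (by nlinarith) d' v' ε' hstrip

end OneCut

end Summit.ValiantsHypothesis.ValiantsHypothesis.Theorems.KPlusLogSqLaw
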